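import Mathlib
import Literature.Geometry.DiscreteGeometry.DelaunaySubdivision
import Literature.Geometry.DiscreteGeometry.SolidAngleFraction
import Summits.AtomisticToContinuum.Crystallization.Theorems.SquareWellLayerCakeAveragedTwelveVertexFlat
import Summits.AtomisticToContinuum.Crystallization.Theorems.SquareWellLayerCakeAveragedTwelveEdgeFlat
import Summits.AtomisticToContinuum.Crystallization.Theorems.SquareWellLayerCakeAveragedTwelveGirardCell
import Summits.AtomisticToContinuum.Crystallization.Theorems.SquareWellLayerCakeAveragedTwelveAssemble
import Summits.AtomisticToContinuum.Crystallization.Theorems.SquareWellLayerCakeAveragedTwelveQrRange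
import HarnessLib

/-!
# Line `Sketch` (par-five-delaunay-recount), crux `SquareWellLayerCake.AveragedTwelve`
# (stmt-AtomisticToContinuum-15806): the ALL-NEAR VERTEX theorem (`stub_allNearVertex`)

First structural theorem of the line at the crux's own ratio 57/50 (the card's (T2) at rung 2, the
`AllNearAlphabet` of idea skin-deep-polytetrahedra without the `{12,14,15}` classification): at an
interior vertex `v` of a triangulation all of whose cells at `v` are QUASI-REGULAR (six edge lengths in
`[d, (57/50)d]`), every edge `vz` has valence `t_vz ∈ {5, 6}` and
`deg v − 12 = #{z : t_vz = 6} ≥ 0`.  Proof: the Euler link recount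
`deg v − 12 = Σ_z (t_vz − 5)` (landed partitions of unity + Girard, combined by
`ParFiveRecountAssemble.recount_comb`) and the quasi-regular dihedral range `df ∈ (1/7, 1/4)`
(`stub_qrDihedralRange`) with `Σ_{t ∋ v,z} df = 1` (`stub_edgeFlat`) give `4 < t_vz < 7`.
-/

noncomputable section

open scoped BigOperators Classical

namespace Summit.AtomisticToContinuum.Crystallization.Theorems.ParFiveRecountAllNear

open Literature.Geometry.DiscreteGeometry
open Summit.AtomisticToContinuum.Crystallization.Theorems

/-- If `n` numbers each in `(1/7, 1/4)` sum to `1` then `n = 5` or `n = 6`. [folklore] -/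
theorem card_eq_five_or_six {ι : Type*} (s : Finset ι) (f : ι → ℝ)
    (hlo : ∀ i ∈ s, 1 / 7 < f i) (hhi : ∀ i ∈ s, f i < 1 / 4) (hsum : ∑ i ∈ s, f i = 1) :
    s.card = 5 ∨ s.card = 6 := by
  have hne : s.Nonempty := by
    rw [Finset.nonempty_iff_ne_empty]; rintro rfl; simp at hsum
  have h1 : (s.card : ℝ) * (1 / 7) < 1 := by
    calc (s.card : ℝ) * (1 / 7) = ∑ i ∈ s, (1 / 7 : ℝ) := by rw [Finset.sum_const, nsmul_eq_mul]
      _ < ∑ i ∈ s, f i := Finset.sum_lt_sum_of_nonempty hne hlo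
      _ = 1 := hsum
  have h2 : (1 : ℝ) < s.card * (1 / 4) := by
    calc (1 : ℝ) = ∑ i ∈ s, f i := hsum.symm
      _ < ∑ i ∈ s, (1 / 4 : ℝ) := Finset.sum_lt_sum_of_nonempty hne hhi
      _ = s.card * (1 / 4) := by rw [Finset.sum_const, nsmul_eq_mul]
  have h3 : s.card < 7 := by
    have : (s.card : ℝ) < 7 := by linarith
    exact_mod_cast this
  have h4 : 4 < s.card := by
    have : (4 : ℝ) < s.card := by linarith
    exact_mod_cast this
  omega

/-- **The all-near vertex theorem** (registered stub `stub_allNearVertex` of line `Sketch`). -/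
theorem stub_allNearVertex : ∀ (d : ℝ), 0 < d → ∀ (ω : Finset (EuclideanSpace ℝ (Fin 3))) (K : Geometry.SimplicialComplex ℝ (EuclideanSpace ℝ (Fin 3))), Literature.Geometry.DiscreteGeometry.IsTriangulation (↑ω : Set (EuclideanSpace ℝ (Fin 3))) K → ∀ v ∈ ω, v ∈ interior (convexHull ℝ (↑ω : Set (EuclideanSpace ℝ (Fin 3)))) → ∀ (Nb : Finset (EuclideanSpace ℝ (Fin 3))), (∀ z, z ∈ Nb ↔ z ≠ v ∧ ({v, z} : Finset (EuclideanSpace ℝ (Fin 3))) ∈ K.faces) → ∀ (Sv : Finset (Finset (EuclideanSpace ℝ (Fin 3)))), (∀ t, t ∈ Sv ↔ t ∈ K.faces ∧ v ∈ t ∧ t.card = 4) → (∀ t ∈ Sv, ∀ a ∈ t, ∀ b ∈ t, a ≠ b → d ≤ dist a b ∧ dist a b ≤ 57 / 50 * d) → (∀ z ∈ Nb, (Sv.filter (fun t => z ∈ t)).card = 5 ∨ (Sv.filter (fun t => z ∈ t)).card = 6) ∧ ((Nb.card : ℤ) - 12 = ((Nb.filter (fun z => (Sv.filter (fun t => z ∈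 t)).card = 6)).card : ℤ)) := by
  intro d hd ω K hK v hv hint Nb hNb Sv hSv hqr
  -- valences are 5 or 6
  have hval : ∀ z ∈ Nb, (Sv.filter (fun t => z ∈ t)).card = 5 ∨ (Sv.filter (fun t => z ∈ t)).card = 6 := by
    intro z hz
    have hz' := (hNb z).1 hz
    have hchar : ∀ t, t ∈ Sv.filter (fun t => z ∈ t) ↔ t ∈ K.faces ∧ v ∈ t ∧ z ∈ t ∧ t.card = 4 := by
      intro t; simp only [Finset.mem_filter, hSv]; tauto
    have hsum := ParFiveRecountEdgeFlat.stub_edgeFlat ω K hK v hv hint z hz'.1 hz'.2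
      (Sv.filter (fun t => z ∈ t)) hchar
    refine card_eq_five_or_six _ _ (fun t ht => ?_) (fun t ht => ?_) hsum
    · have h := (hchar t).1 ht
      exact (ParFiveRecountQrRange.stub_qrDihedralRange d hd K t h.1 h.2.2.2 (hqr t (Finset.mem_filter.1 ht).1) v h.2.1 z
        (Finset.mem_erase.2 ⟨hz'.1, h.2.2.1⟩)).1
    · have h := (hchar t).1 ht
      exact (ParFiveRecountQrRange.stub_qrDihedralRange d hd K t h.1 h.2.2.2 (hqr t (Finset.mem_filter.1 ht).1) v h.2.1 z
        (Finset.mem_erase.2 ⟨hz'.1, h.2.2.1⟩)).2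
  refine ⟨hval, ?_⟩
  -- Euler link recount at v
  have hrec : ((Nb.card : ℤ) - 12) = ∑ z ∈ Nb, ((((Sv.filter (fun t => z ∈ t)).card : ℤ)) - 5) := by
    refine ParFiveRecountAssemble.recount_comb Sv Nb v
      (fun t => ballFraction v (apexCone v (fun w : ↥(t.erase v) => (↑w : EuclideanSpace ℝ (Fin 3)) - v)))
      (fun t z => ballFraction v (apexWedge v (z - v)
        (fun w : ↥((t.erase v).erase z) => (↑w : EuclideanSpace ℝ (Fin 3)) - v)))
      (fun t ht => ⟨((hSv t).1 ht).2.1, ((hSv t).1 ht).2.2⟩) ?_ ?_ ?_ ?_ ?_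
    · intro t ht z hzt hzv
      rw [hNb]
      refine ⟨hzv, K.down_closed ((hSv t).1 ht).1 ?_ (Finset.insert_nonempty _ _)⟩
      intro w hw
      rcases Finset.mem_insert.1 hw with rfl | hw
      · exact ((hSv t).1 ht).2.1
      · rw [Finset.mem_singleton.1 hw]; exact hzt
    · rw [hNb]; exact fun h => h.1 rfl
    · exact ParFiveRecountVertexFlat.stub_vertexFlat ω K hK v hv hint Sv hSv
    · intro z hz
      have hz' := (hNb z).1 hz
      refine ParFiveRecountEdgeFlat.stub_edgeFlat ω K hK v hv hint z hz'.1 hz'.2 (Sv.filter fun t => z ∈ t) ?_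
      intro t; simp only [Finset.mem_filter, hSv]; tauto
    · intro t ht
      exact ParFiveRecountGirardCell.stub_girardCell K t ((hSv t).1 ht).1 ((hSv t).1 ht).2.2 v ((hSv t).1 ht).2.1
  rw [hrec]
  -- Σ_z (t_z − 5) = #{z : t_z = 6}
  rw [Finset.card_eq_sum_ones, Nat.cast_sum, Finset.sum_filter]
  refine Finset.sum_congr rfl fun z hz => ?_
  rcases hval z hz with h | h
  · rw [h, if_neg (by norm_num)]; norm_num
  · rw [h, if_pos rfl]; norm_num

end Summit.AtomisticToContinuum.Crystallization.Theorems.ParFiveRecountAllNear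

end
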